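import Literature.AlgebraicGeometry.HodgeTheory.EllipticCurvesProductsHodgeClassesOfRiemann
import Literature.AlgebraicGeometry.Motives.SegreHyperplaneClassProdWeighted
import HarnessLib

/-!
# The power `T^{N+1}` as a product cone, and its Segre embedding with a product hyperplane class

Layer `Literature/AlgebraicGeometry/HodgeTheory`; theorems only, no definition, no named fact (D-0026,
net debt 0). Cell `pub-hodgecm2` (COR-CM), literature seat `lit-andre-2` gen 9: the geometric input of
the tensor point `A₀ ⊗ E = T^{2e₀}` of [Deligne1982HodgeCycles, proof of Thm. 4.8] /
[Andre1996Motifs, proof of Lemme 6.3.3] in the format of the companion-cone theorems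
(`Deligne1982/TensorPointWeilTypeCM`, `Deligne1982/TensorPointSplitPolarization`), which take a
PRODUCT CONE `IsLimit (Fan.mk A q)` over `n + 1` copies of `T` and a projective embedding of `A` whose
hyperplane class is a PRODUCT CLASS `Σ_j q_j^* h₀`.

* `powSlots_hom_ext`, `nonempty_isLimit_fan_powSlots` — the iterated binary product
  `T.powSucc N = (⋯(T × T) × ⋯) × T` with its slot projections `powSlots T N`
  (`NonCMEllipticCurvePowersHodgeClasses`) IS a product cone in `AbelianVariety ℂ` (universal map
  `powSlotsLift`, `EllipticCurvesProductsHodgeClassesOfRiemann` §5; uniqueness by `prod_hom_ext`).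
* `exists_segreEmbedding_powSucc` — one projective embedding `e_T` of `T` with a non-zero rational
  ambient class `a_T`, and for every `N` a projective embedding of `T^{N+1}` (iterated Segre embedding,
  Hartshorne II Ex. 5.11–5.12) whose hyperplane class is `Σ_j pr_j^*(e_T^* a_T)` — the SAME class on
  every factor (Segre additivity on `H²`, `exists_segreHyperplaneClasses`).
* `exists_companion_powSucc` — the companion endomorphism of a monic `P = x^{n+1} + Σ a_j x^j` on
  `T^{n+1}` (`φ ≫ pr₀ = -a₀ pr_n`, `φ ≫ pr_{j+1} = pr_j - a_{j+1} pr_n`), lifted through the cone.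

## References

* [LangeBirkenhake1992] H. Lange, Ch. Birkenhake, Complex Abelian Varieties (1992), Thm. 4.2.1.
* [Hartshorne1977] R. Hartshorne, Algebraic Geometry (1977), II Ex. 5.11–5.12.
* [Deligne1982HodgeCycles] P. Deligne, Hodge cycles on abelian varieties, LNM 900 (1982), §4 (4.3)
  and proof of Thm. 4.8.
-/

noncomputable section

open CategoryTheory CategoryTheory.Limits MonoidalCategory AlgebraicGeometry
open Literature.AlgebraicGeometry.Motives
open Literature.AlgebraicGeometry.Motives.SegreHyperplaneClass
  (exists_closedImmersion_projectiveSpace_pos map_comp_apply' map_tensorHom_map_fst map_tensorHom_map_snd)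

namespace Literature.AlgebraicGeometry.HodgeTheory

variable {T B : AbelianVariety ℂ}

/-! ### The power is a product cone -/

/-- **Joint monicity of the slot projections**: two homomorphisms into `T^{N+1}` with the same
components along `powSlots T N` are equal (iterated `prod_hom_ext`). [cite: LangeBirkenhake1992, Thm. 4.2.1] -/
theorem powSlots_hom_ext : ∀ (N : ℕ) {f g : B ⟶ T.powSucc N},
    (∀ j, f ≫ powSlots T N j = g ≫ powSlots T N j) → f = g
  | 0, f, g, h => by
    have h0 := h 0
    change f ≫ 𝟙 (T.powSucc 0) = g ≫ 𝟙 (T.powSucc 0) at h0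
    rwa [Category.comp_id, Category.comp_id] at h0
  | N + 1, f, g, h => by
    refine Motives.AbelianVariety.prod_hom_ext (A := T.powSucc N) (B := T) ?_ ?_
    · refine powSlots_hom_ext N fun j => ?_
      have hj := h (Fin.castAdd 1 j)
      change f ≫ Fin.append _ _ (Fin.castAdd 1 j) = g ≫ Fin.append _ _ (Fin.castAdd 1 j) at hj
      rw [Fin.append_left] at hj
      rw [Category.assoc, Category.assoc]
      exact hj
    · have hj := h (Fin.natAdd (N + 1) 0)
      change f ≫ Fin.append _ _ (Fin.natAdd (N + 1) 0) = g ≫ Fin.append _ _ (Fin.natAdd (N + 1) 0) at hj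
      rw [Fin.append_right] at hj
      change f ≫ (Motives.AbelianVariety.snd (T.powSucc N) T ≫ 𝟙 T) =
        g ≫ (Motives.AbelianVariety.snd (T.powSucc N) T ≫ 𝟙 T) at hj
      rwa [Category.comp_id] at hj

/-- **`(T^{N+1}, pr₀, …, pr_N)` is a product cone** in `AbelianVariety ℂ`: the fan
`Fan.mk (T.powSucc N) (powSlots T N)` is a limit (lift `powSlotsLift`, components
`powSlotsLift_powSlots`, uniqueness `powSlots_hom_ext`). [cite: LangeBirkenhake1992, Thm. 4.2.1] -/
theorem nonempty_isLimit_fan_powSlots (T : AbelianVariety ℂ) (N : ℕ) :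
    Nonempty (IsLimit (Fan.mk (T.powSucc N) (powSlots T N))) :=
  ⟨Fan.IsLimit.mk _ (fun s => powSlotsLift N fun j => s.proj j)
    (fun s j => powSlotsLift_powSlots N (fun j => s.proj j) j)
    (fun s m hm => powSlots_hom_ext N fun j => by
      rw [powSlotsLift_powSlots]
      exact hm j)⟩

/-- `dim T^{N+1} = (N + 1) · dim T`, restated next to the cone. [cite: LangeBirkenhake1992, Thm. 4.2.1] -/
theorem dim_powSucc' (T : AbelianVariety ℂ) (N : ℕ) : (T.powSucc N).dim = (N + 1) * T.dim :=
  dim_powSucc T N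

/-! ### The companion endomorphism of a monic polynomial on `T^{n+1}` -/

/-- **The companion endomorphism** of `P = x^{n+1} + Σ_j a_j x^j ∈ ℤ[x]` on `T^{n+1}`
(multiplication by `x` on `T ⊗_ℤ ℤ[x]/(P)` in the basis `1, x, …, x^n`): `φ ≫ pr₀ = -a₀ · pr_n` and
`φ ≫ pr_{j+1} = pr_j - a_{j+1} · pr_n`, lifted through the product cone. [cite: Deligne1982HodgeCycles, §4 (4.3) and proof of Thm. 4.8] -/
theorem exists_companion_powSucc (T : AbelianVariety ℂ) (n : ℕ) (a : Fin (n + 1) → ℤ) :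
    ∃ φ : T.powSucc n ⟶ T.powSucc n,
      φ ≫ powSlots T n 0 = -(a 0 • powSlots T n (Fin.last n)) ∧
      ∀ j : Fin n, φ ≫ powSlots T n j.succ = powSlots T n (Fin.castSucc j) - a j.succ • powSlots T n (Fin.last n) := by
  let c : Fin (n + 1) → (T.powSucc n ⟶ T) :=
    Fin.cases (-(a 0 • powSlots T n (Fin.last n)))
      (fun j => powSlots T n (Fin.castSucc j) - a j.succ • powSlots T n (Fin.last n))
  refine ⟨powSlotsLift n c, ?_, fun j => ?_⟩
  · rw [powSlotsLift_powSlots]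
    exact Fin.cases_zero
  · rw [powSlotsLift_powSlots]
    exact Fin.cases_succ j

/-! ### The Segre embedding of the power, with a product hyperplane class -/

/-- **Segre embeddings of the powers `T^{N+1}` with the same class on every factor** (Hartshorne II
Ex. 5.11–5.12, `𝒪(1, …, 1)`): ONE projective embedding `e_T` of `T` with a non-zero rational ambient
class `a_T`, and for every `N` a projective embedding `e` of `T^{N+1}` with a non-zero rational ambient
class `a` such that `e^* a = Σ_j pr_j^*(e_T^* a_T)` (iterated Segre embedding
`(e_N ⊗ e_T) ≫ σ`; Segre additivity `σ^* g = pr₁^* g + pr₂^* g`, `exists_segreHyperplaneClasses`).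
[cite: Hartshorne1977, II Ex. 5.11 and Ex. 5.12] [cite: LangeBirkenhake1992, Thm. 4.2.1] -/
theorem exists_segreEmbedding_powSucc (T : AbelianVariety ℂ) :
    ∃ (eT : ProjectiveEmbedding T.X) (aT : complexBetti (projectiveSpace eT.n ℂ) 2),
      IsRationalClass aT ∧ aT ≠ 0 ∧
      ∀ N : ℕ, ∃ (e : ProjectiveEmbedding (T.powSucc N).X) (a : complexBetti (projectiveSpace e.n ℂ) 2),
        IsRationalClass a ∧ a ≠ 0 ∧
        complexBetti.map e.ι 2 a =
          ∑ j : Fin (N + 1), complexBetti.map (powSlots T N j).hom.hom.hom 2 (complexBetti.map eT.ι 2 aT) := by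
  obtain ⟨g, hgr, hgnz, hgσ⟩ := exists_segreHyperplaneClasses
  obtain ⟨N₀, e₀, hN₀, he₀⟩ := exists_closedImmersion_projectiveSpace_pos T
  haveI := he₀
  -- the inductive construction, keeping the ambient class `g`
  have key : ∀ N : ℕ, ∃ e : ProjectiveEmbedding (T.powSucc N).X, 1 ≤ e.n ∧
      complexBetti.map e.ι 2 (g e.n) =
        ∑ j : Fin (N + 1), complexBetti.map (powSlots T N j).hom.hom.hom 2 (complexBetti.map e₀ 2 (g N₀)) := by
    intro N
    induction N with
    | zero =>
      refine ⟨⟨N₀, e₀, he₀⟩, hN₀, ?_⟩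
      rw [Fin.sum_univ_one]
      change complexBetti.map e₀ 2 (g N₀) = complexBetti.map (𝟙 T.X) 2 (complexBetti.map e₀ 2 (g N₀))
      rw [complexBetti.map_id]
      rfl
    | succ N ih =>
      obtain ⟨eN, hn, heN⟩ := ih
      obtain ⟨ι, hι⟩ : ∃ ι : (T.powSucc N).X ⊗ T.X ⟶ projectiveSpace (eN.n * N₀ + eN.n + N₀) ℂ,
          ι = (eN.ι ⊗ₘ e₀) ≫ segreEmbedding eN.n N₀ ℂ := ⟨_, rfl⟩
      haveI := isClosedImmersion_tensorHom_left (X := (T.powSucc N).X) (Y := T.X) eN.ι e₀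
      have hιci : IsClosedImmersion ι.left := by
        rw [hι]
        change IsClosedImmersion ((eN.ι ⊗ₘ e₀).left ≫ (segreEmbedding eN.n N₀ ℂ).left)
        infer_instance
      have hKK : 1 ≤ eN.n * N₀ + eN.n + N₀ := le_trans hN₀ (Nat.le_add_left _ _)
      refine ⟨⟨_, ι, hιci⟩, hKK, ?_⟩
      have final : complexBetti.map ι 2 (g _) =
          complexBetti.map (CartesianMonoidalCategory.fst (T.powSucc N).X T.X) 2 (complexBetti.map eN.ι 2 (g eN.n)) +
            complexBetti.map (CartesianMonoidalCategory.snd (T.powSucc N).X T.X) 2 (complexBetti.map e₀ 2 (g N₀)) := by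
        rw [hι, map_comp_apply', hgσ, map_add, map_tensorHom_map_fst, map_tensorHom_map_snd]
      change complexBetti.map ι 2 (g _) = _
      rw [final, heN, map_sum]
      conv_rhs => rw [Fin.sum_univ_add, Fin.sum_univ_one]
      congr 1
      · refine Finset.sum_congr rfl fun j _ => ?_
        change _ = complexBetti.map (Fin.append _ _ (Fin.castAdd 1 j) : T.powSucc (N + 1) ⟶ T).hom.hom.hom 2 _
        rw [Fin.append_left, ← complexBetti_map_map_hom]
        rfl
      · change _ = complexBetti.map (Fin.append _ _ (Fin.natAdd (N + 1) 0) : T.powSucc (N + 1) ⟶ T).hom.hom.hom 2 _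
        rw [Fin.append_right]
        change _ = complexBetti.map (Motives.AbelianVariety.snd (T.powSucc N) T ≫ 𝟙 T).hom.hom.hom 2 _
        rw [Category.comp_id]
        rfl
  refine ⟨⟨N₀, e₀, he₀⟩, g N₀, hgr N₀, hgnz N₀ hN₀, fun N => ?_⟩
  obtain ⟨e, hn, he⟩ := key N
  exact ⟨e, g e.n, hgr _, hgnz _ hn, he⟩

end Literature.AlgebraicGeometry.HodgeTheory

end
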